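import Mathlib
import Summits.QuantumFields.BalabanUV.Beta.AnalyticWalkSum216RowConstrainedCoercive
import Summits.QuantumFields.BalabanUV.Beta.UnitLatticeOmegaBoxEnd

/-!
# [Balaban1985BackgroundPropagators] (3.132) p. 422 ∕ [Balaban1988RG2Cluster] p. 13 — THE COARSE LAYER'S BOX END WITH THE
# COERCIVITY DATUM REPLACED BY A QUASI-RECONSTRUCTION: co-owner d4-p3's numbers-only END
# `UnitLatticeOmegaBoxEnd.termSum_box_end` (p220091) composed with the owner's `hRe_coarse_of_quasiReconstruction`
# (p220100) — for the coarse pieces `Kp` of interface item (I3) (`Σ_ω Kp_ω = Eᵀ(Q̃A⁻¹Q̃ᵀ − 1)E`) the fully decorated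
# ω-expansion with CONSTRUCTED local inverses sums to `(1 + Σ_ω Kp_ω)⁻¹` given ONE (T3)-shape bound, a quasi-reconstruction
# for `Q̃` w.r.t. `A = G₂⁻¹`, row-locality, the near convention and closed-form numbers — NO coercivity datum left
# (cell topic `Summits/QuantumFields/BalabanUV/Beta`; row-D4 NODE A.4, interface item (I3))

HONEST FRAMING (cell rule).  Discharging `BetaPertH` makes Bałaban's UV stability UNCONDITIONAL — a real constructive-QFT
result; NOT the continuum limit, NOT the Clay problem.  This module discharges NOTHING of `BetaPertH`.  [folklore]: the
«ten-line composition» named by both seats (d4-p3's XREAD C-d4p3-12 INFO-1; the owner's XREAD C-an4-109 INFO-1) —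
nothing new is proved; the two accepted modules are plugged BY NAME.  Its value is the HYPOTHESIS LIST it displays for the
coarse layer of (I3): (i) `hT`∕`hTc` — ONE (T3)-shape bound on the coarse pieces (rows + columns) [= (I1)+(I2) at shifted
rates; NOT moved]; (ii) a quasi-reconstruction `(r, c, E₀)` for `Q̃` relative to `A` [= E-I3, NOTE-I3; MODEL instances:
`CoarseCoerciveBlock1D` (ν = 1), d4-p2's «E-I3-U1-TENSOR» (ν-dim, claimed)]; (iii) the instance statement `hKtot`
(C-an4-101), `A` Hermitian invertible `Re`-psd, `Q̃` real, representatives `e : μ ↪ Y`; (iv) row-locality in cells, the near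
convention; (v) closed-form numbers with `γ := min(c²∕E₀, 1)`.  Nothing of Bałaban's operators is instantiated; NO class
change on any GAPS row; readiness width 0 unchanged; NOT summit progress.  Unit `b2b-balaban-beta-an4-g39` (owner lineage
of `BINDER-OWNERS.md` row D4); `GAPS.md` C-an4-112.

CITATION HEADER (lean-in-tree rule).  [13] = T. Bałaban, *Propagators for lattice gauge theories in a background field*,
Commun. Math. Phys. **99**, 389–434 (1985) [Balaban1985BackgroundPropagators], p. 422; [II] = T. Bałaban, *Renormalization
group approach to lattice gauge field theories. II. Cluster expansions*, Commun. Math. Phys. **116**, 1–22 (1988)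
[Balaban1988RG2Cluster], p. 13 after (2.7).  LOCATORS only; nothing printed is asserted.

WHAT IS CERTIFIED HERE (kernel, sorry-free; [folklore]).  **`termSum_box_end_of_quasiReconstruction`** — the composition.
NOT CLAIMED.  Anything beyond the two plugged modules.  NOT summit progress.
PRIOR ART IN THE TREE: `UnitLatticeOmegaBoxEnd.termSum_box_end` (p220091), `AnalyticWalkSum216RowConstrainedCoercive.
hRe_coarse_of_quasiReconstruction` (p220100) — USED BY NAME; nothing else like it (both XREADs searched).
-/

open scoped BigOperators Matrix
open Finset Matrix Metric Real

namespace Summit.QuantumFields.BalabanUV.Beta.AnalyticWalkSum216RowConstrainedBoxEnd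

open Summit.QuantumFields.BalabanUV.Beta.UnitLatticeWalkInversion
open Summit.QuantumFields.BalabanUV.Beta.UnitLatticeTubeCount (supDist supDistOn)
open Summit.QuantumFields.BalabanUV.Beta.UnitLatticePartition (hPart EPart)
open Summit.QuantumFields.BalabanUV.Beta.UnitLatticeWalkInversionDecay (locInv)
open Summit.QuantumFields.BalabanUV.Beta.UnitLatticeOmegaTerms
open Summit.QuantumFields.BalabanUV.Beta.UnitLatticeOmegaRowData
open Summit.QuantumFields.BalabanUV.Beta.UnitLatticeOmegaBox
open Summit.QuantumFields.BalabanUV.Beta.UnitLatticeOmegaBoxEnd (termSum_box_end)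
open Summit.QuantumFields.BalabanUV.Beta.UnitLatticeResolventWalk (Qm superpose)
open Summit.QuantumFields.BalabanUV.Beta.AnalyticWalkSum216 (termSum)
open Summit.QuantumFields.BalabanUV.Beta.AnalyticWalkSum216RowResolvent (pieceMaj)
open Summit.QuantumFields.BalabanUV.Beta.AnalyticWalkSum216RowConstrainedDict (embM)
open Summit.QuantumFields.BalabanUV.Beta.AnalyticWalkSum216RowConstrainedCoercive (hRe_coarse_of_quasiReconstruction)
open Literature.MathematicalPhysics.QuantumFieldTheory.Balaban1983to89.B5Prop11Lower (nsq)

noncomputable section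

variable {Y : Type*} [Fintype Y] [DecidableEq Y] {Ω : Type*} [Fintype Ω] [DecidableEq Ω] {ν q : ℕ}
  {μ X : Type*} [Fintype μ] [Fintype X] [DecidableEq μ] [DecidableEq X]

/-- **THE COARSE LAYER'S BOX END, COERCIVITY DATUM REPLACED BY A QUASI-RECONSTRUCTION.**  `termSum_box_end` (d4-p3, p220091)
with `hRe` supplied by `hRe_coarse_of_quasiReconstruction` (owner, p220100) at `γ := min(c²∕E₀, 1)`: for coarse pieces
`Kp` with `Σ_ω Kp_ω = Eᵀ(Q̃A⁻¹Q̃ᵀ − 1)E` (`E = embM rep`, `rep : μ ↪ Y`), `A` Hermitian invertible `Re`-psd, `Q̃` real, a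
quasi-reconstruction `r` (mass coercivity `c`, energy `E₀`), ONE (T3)-shape bound (rows `hT`, columns `hTc`), row-locality
in cells, the near convention and the displayed numbers: the fully decorated ω-expansion with constructed local inverses
sums to `(1 + Σ_ω Kp_ω)⁻¹` at `s ≡ 1`. [cite: Balaban1985BackgroundPropagators, (3.132) p.422] -/
theorem termSum_box_end_of_quasiReconstruction (hν : 0 < ν) {M Md : ℕ} (hM : 0 < M) (hMd : 8 * M ≤ Md)
    (e : Y → (Fin ν → ℤ)) (he : Function.Injective e) (hbox : ∀ y i, 0 ≤ e y i ∧ e y i ≤ q * M)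
    {κ κ₁ κ₂ κp ρ ρc m₀ κc : ℝ} (hκ : 0 ≤ κ) (hκ₁ : 0 < κ₁) (hκ₂ : 0 ≤ κ₂)
    (Kp : Ω → Matrix Y Y ℂ) (cellsOf : Ω → Finset (Fin ν → ℤ))
    (hKcells : ∀ ω k l, Kp ω k l ≠ 0 → cellAt Md e k ∈ cellsOf ω)
    (near : (Fin ν → Fin (q + 1)) → Finset Ω) (hnear : ∀ b ω, ω ∉ near b → m₀ ≤ (cellsOf ω).card)
    (hκc : κ + κ₁ * ((2 ^ ν : ℕ) / (2 * (M : ℝ))) < κc) (hκcp : κc < κp)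
    (hT : ∀ k, ∑ l, (∑ ω, pieceMaj (κ₁ + κ₂) Kp cellsOf ω k l) * Real.exp (κp * supDistOn e k l) ≤ ρ)
    (hTc : ∀ l, ∑ k, (∑ ω, pieceMaj (κ₁ + κ₂) Kp cellsOf ω k l) * Real.exp (κp * supDistOn e k l) ≤ ρc)
    -- the coercivity datum REPLACED: representatives, instance statement, fine form, real averaging, quasi-reconstruction
    (rep : μ → Y) (hrep : Function.Injective rep) (A : Matrix X X ℂ) (hH : A.IsHermitian) (hU : IsUnit A)
    (hpsd : ∀ g : X → ℂ, 0 ≤ (star g ⬝ᵥ (A *ᵥ g)).re) (Qt : Matrix μ X ℂ)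
    (hreal : ∀ a x, (starRingEnd ℂ) (Qt a x) = Qt a x) (r : μ → X → ℂ) {c E₀ : ℝ} (hc : 0 < c) (hE₀ : 0 < E₀)
    (hmass : ∀ B : μ → ℂ, c * nsq B ≤ (star (superpose r B) ⬝ᵥ superpose (fun a x => Qt a x) B).re)
    (hen : ∀ B : μ → ℂ, (star (superpose r B) ⬝ᵥ (A *ᵥ superpose r B)).re ≤ E₀ * nsq B)
    (hKtot : Ktot Kp = (embM rep)ᵀ * (Qt * A⁻¹ * Qtᵀ - 1) * embM rep)
    -- the numbers, at γ := min (c²/E₀) 1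
    (hm : κc * ρ * ((Real.exp 1 * ((κp - κc) / 2))⁻¹
          * (2 * (1 - Real.exp (-((κp - κc - (κp - κc) / 2) / ν)))⁻¹) ^ ν)
        < min (c ^ 2 / E₀) 1 - Real.exp (-((κ₁ + κ₂) * m₀)) * (ρ + ρc) / 2)
    (hρ : (min (c ^ 2 / E₀) 1 - Real.exp (-((κ₁ + κ₂) * m₀)) * (ρ + ρc) / 2
          - κc * ρ * ((Real.exp 1 * ((κp - κc) / 2))⁻¹
            * (2 * (1 - Real.exp (-((κp - κc - (κp - κc) / 2) / ν)))⁻¹) ^ ν))⁻¹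
        * (2 * (1 - Real.exp (-((κc - (κ + κ₁ * ((2 ^ ν : ℕ) / (2 * (M : ℝ))))) / ν)))⁻¹) ^ ν
        * (2 * (2 : ℝ) ^ ν / (2 * (M : ℝ) / (ν * π))
          * ((Real.exp 1 * (κp - (κ + κ₁ * ((2 ^ ν : ℕ) / (2 * (M : ℝ))))))⁻¹ * ρ)
          + (2 : ℝ) ^ ν * Real.exp (-(κ₂ * m₀)) * ρ) < 1) (Δ₀ : Fin ν → ℤ) :
    termSum (decFamilyΩ (cellAt Md e) (EPart M q e) (domOf Md e cellsOf) (hPart M q e) Kp near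
      (fun b => locInv (Knear Kp near b) (EPart M q e) b) (fun _ => (1 : ℂ)) Δ₀) 1 = (1 + Ktot Kp)⁻¹ :=
  termSum_box_end hν hM hMd e he hbox hκ hκ₁ hκ₂ Kp cellsOf hKcells near hnear hκc hκcp hT hTc
    (hRe_coarse_of_quasiReconstruction rep hrep A hH hU hpsd Qt hreal r hc hE₀ hmass hen Kp hKtot) hm hρ Δ₀

end

end Summit.QuantumFields.BalabanUV.Beta.AnalyticWalkSum216RowConstrainedBoxEnd
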